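import Summits.Parity.GeneralizedHardyLittlewood.Theses.LiouvilleMAD

/-!
# `LambdaLiouvilleLevel` (stmt-Parity-13325): level tightness — level `N/(log N)^B` and level one fail

NEGATIVE LEMMAS (natural strengthenings refuted) for the crux
`Summit.Parity.GeneralizedHardyLittlewood.Theses.LiouvilleMAD.LambdaLiouvilleLevel`
(Bombieri–Vinogradov at level `N^{ε₀}` for `Λ(n)λ(n+h)`, ONE residue `w q` and ONE height
`y q ≤ N` per modulus, residues NOT required coprime to the modulus), from the standing disprover's
work file `Cruxes/LambdaLiouvilleLevel/Disproof.lean` (cycle 1):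

* `not_lambdaLiouvilleLevel_logPowerLevel` — the level `⌊N^{ε₀}⌋` replaced by `⌊N/(log N)^B⌋`
  (`B ≥ 0` fixed, no `ε₀`; everything else verbatim): FALSE. Residues `w_q = 0` and heights
  `y_q = q` make modulus `q` catch exactly its own term `n = q` (`moduliSum_zero_residue_eq_psi`:
  the modulus sum IS `ψ(level)`), and `ψ(N/(log N)^B) ≥ (N/(log N)^B - 1) log 2 - log(N+1)` is
  never `≤ C N/(log N)^{B+1}` for large `N` (`A = B + 1`).
* `not_lambdaLiouvilleLevel_levelOne` — moduli `q ≤ N`: the case `B = 0`.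

MORAL for planners: an Elliott–Halberstam-type strengthening of this one-residue-per-modulus
statement must keep a power level `N^θ, θ < 1` (this attack then yields only `ψ(N^θ) ~ N^θ`, far
below `N/(log N)^A`) or restrict to residues coprime to the modulus. The crux itself (level
`N^{ε₀}`) is untouched by it. Mathlib only (`Chebyshev.psi_ge`, `isLittleO_log_rpow_rpow_atTop`);
no named facts, no defs. [folklore]
-/

namespace Summit.Parity.GeneralizedHardyLittlewood.Theorems.LambdaLiouvilleLevel.Negative

open Finset Filter Asymptotics
open ArithmeticFunction (vonMangoldt liouville)

/-! ## Natural strengthenings refuted: level `N/(log N)^B` (`B ≥ 0`) and level one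

With residues `w_q = 0` and heights `y_q = q`, modulus `q` sees exactly the term `n = q`, so the
modulus sum up to a level `Q ≤ N` is `Σ_{q≤Q} Λ(q) = ψ(Q)`. -/

/-- The zero class of modulus `q ≥ 1` inside `[1, q]` is `{q}`. [folklore] -/
theorem filter_Icc_modEq_zero_self {q : ℕ} (hq : 1 ≤ q) :
    (Icc 1 q).filter (fun n : ℕ => n ≡ 0 [MOD q]) = {q} := by
  ext n
  simp only [mem_filter, mem_Icc, mem_singleton, Nat.modEq_zero_iff_dvd]
  constructor
  · rintro ⟨⟨h1, h2⟩, hdvd⟩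
    exact le_antisymm h2 (Nat.le_of_dvd (by omega) hdvd)
  · rintro rfl
    exact ⟨⟨hq, le_rfl⟩, dvd_rfl⟩

/-- **Diagonal extraction.** With `w ≡ 0`, `y q = min q N` and shift `h = 1`, the modulus sum up to
any level `Q ≤ N` equals `ψ(Q)`. [folklore] -/
theorem moduliSum_zero_residue_eq_psi {Q N : ℕ} (hQN : Q ≤ N) :
    (∑ q ∈ Icc 1 Q, |∑ n ∈ (Icc 1 (min q N)).filter (fun n : ℕ => n ≡ 0 [MOD q]),
        vonMangoldt n * ((liouville (Int.toNat ((n : ℤ) + 1)) : ℤ) : ℝ)|) = Chebyshev.psi Q := by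
  have hIcc : Icc 1 Q = Ioc 0 Q := by
    ext n
    simp only [mem_Icc, mem_Ioc]
    omega
  rw [Chebyshev.psi, Nat.floor_natCast, ← hIcc]
  refine Finset.sum_congr rfl fun q hq => ?_
  have hq1 : 1 ≤ q := (mem_Icc.mp hq).1
  have hqN : q ≤ N := (mem_Icc.mp hq).2.trans hQN
  rw [min_eq_left hqN, filter_Icc_modEq_zero_self hq1, Finset.sum_singleton, abs_mul,
    abs_of_nonneg ArithmeticFunction.vonMangoldt_nonneg]
  have hto : Int.toNat ((q : ℤ) + 1) = q + 1 := by
    rw [show ((q : ℤ) + 1) = ((q + 1 : ℕ) : ℤ) by omega, Int.toNat_natCast]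
  have habs : |((liouville (q + 1) : ℤ) : ℝ)| = 1 := by
    rw [ArithmeticFunction.liouville_apply (by omega)]
    push_cast
    rw [abs_pow, abs_neg, abs_one, one_pow]
  rw [hto, habs, mul_one]

/-- Real-variable bookkeeping: for `B ≥ 0`, eventually `C·X/L + log 2 + log(x+1) < (X - 1)·log 2`
where `L = log x`, `X = x/L^B` (`(log x)^{B+1} = o(x)`, Mathlib `isLittleO_log_rpow_rpow_atTop`).
[folklore] -/
theorem eventually_logPower_junk_lt (B C : ℝ) (hB : 0 ≤ B) :
    ∀ᶠ x : ℝ in atTop,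
      C * (x / Real.log x ^ B) / Real.log x + Real.log 2 + Real.log (x + 1) <
        (x / Real.log x ^ B - 1) * Real.log 2 := by
  have hl2 : 0 < Real.log 2 := Real.log_pos one_lt_two
  have hl2' : Real.log 2 < 1 := by
    have := Real.log_two_lt_d9; norm_num at this; linarith
  have hc : 0 < Real.log 2 / 16 := by positivity
  have hlo := (isLittleO_log_rpow_rpow_atTop (B + 1) (one_pos : (0 : ℝ) < 1)).bound hc
  filter_upwards [hlo, Real.tendsto_log_atTop.eventually_ge_atTop (4 * |C| / Real.log 2 + 1),
    eventually_ge_atTop (2 : ℝ)] with x hx hlogC hx2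
  have hx0 : 0 < x := by linarith
  have hL1 : 1 ≤ Real.log x := by
    have : 0 ≤ 4 * |C| / Real.log 2 := by positivity
    linarith
  have hL0 : 0 < Real.log x := by linarith
  have hLB : 1 ≤ Real.log x ^ B := Real.one_le_rpow hL1 hB
  have hLB0 : 0 < Real.log x ^ B := by linarith
  set X : ℝ := x / Real.log x ^ B with hX
  have hX0 : 0 < X := div_pos hx0 hLB0
  have hpow : Real.log x ^ (B + 1) ≤ Real.log 2 / 16 * x := by
    rw [Real.norm_eq_abs, Real.norm_eq_abs, abs_of_nonneg (Real.rpow_nonneg hL0.le _),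
      Real.rpow_one, abs_of_pos hx0] at hx
    exact hx
  have hsplit : Real.log x ^ (B + 1) = Real.log x ^ B * Real.log x := Real.rpow_add_one hL0.ne' B
  -- (i) `C X / L ≤ X log 2 / 4`
  have h1 : C * X / Real.log x ≤ X * Real.log 2 / 4 := by
    rw [div_le_iff₀ hL0]
    have hC : |C| ≤ Real.log 2 / 4 * Real.log x := by
      have h' : 4 * |C| / Real.log 2 ≤ Real.log x := by linarith
      rw [div_le_iff₀ hl2] at h'
      linarith
    calc C * X ≤ |C| * X := by gcongr; exact le_abs_self C
      _ ≤ (Real.log 2 / 4 * Real.log x) * X := by gcongr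
      _ = X * Real.log 2 / 4 * Real.log x := by ring
  -- (ii) `log 2 + log (x+1) ≤ X log 2 / 4`, i.e. `L^B (log 2 + log(x+1)) ≤ x log 2 / 4`
  have hlog1 : 0 ≤ Real.log (x + 1) := Real.log_nonneg (by linarith)
  have h2 : Real.log 2 + Real.log (x + 1) ≤ X * Real.log 2 / 4 := by
    have hle : Real.log (x + 1) ≤ Real.log 2 + Real.log x := by
      rw [← Real.log_mul (by norm_num) hx0.ne']
      exact Real.log_le_log (by linarith) (by linarith)
    have h3L : Real.log 2 + Real.log (x + 1) ≤ 4 * Real.log x := by linarith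
    have hkey : Real.log x ^ B * (Real.log 2 + Real.log (x + 1)) ≤ x * Real.log 2 / 4 := by
      calc Real.log x ^ B * (Real.log 2 + Real.log (x + 1))
          ≤ Real.log x ^ B * (4 * Real.log x) := by gcongr
        _ = 4 * Real.log x ^ (B + 1) := by rw [hsplit]; ring
        _ ≤ 4 * (Real.log 2 / 16 * x) := by gcongr
        _ = x * Real.log 2 / 4 := by ring
    rw [hX, show x / Real.log x ^ B * Real.log 2 / 4 = (x * Real.log 2 / 4) / Real.log x ^ B by ring,
      le_div_iff₀ hLB0]
    calc (Real.log 2 + Real.log (x + 1)) * Real.log x ^ B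
        = Real.log x ^ B * (Real.log 2 + Real.log (x + 1)) := by ring
      _ ≤ x * Real.log 2 / 4 := hkey
  have hX4 : 4 ≤ X := by nlinarith
  nlinarith

/-- **Level `N/(log N)^B` is refuted** (every fixed `B ≥ 0`): the crux `LambdaLiouvilleLevel` with
its level `⌊N^{ε₀}⌋` replaced by `⌊N/(log N)^B⌋` (no `ε₀`; everything else verbatim) is FALSE.
Witness: `h = 1`, `A = B + 1`, `w ≡ 0`, `y q = min q N`; the modulus sum is then
`ψ(⌊N/(log N)^B⌋) ≥ (N/(log N)^B - 1) log 2 - log(N+1)`, which beats `C N/(log N)^{B+1}`.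
[folklore] -/
theorem not_lambdaLiouvilleLevel_logPowerLevel {B : ℝ} (hB : 0 ≤ B) :
    ¬ (∀ h : ℤ, h ≠ 0 → ∀ A : ℝ, 0 < A → ∃ C : ℝ, ∃ N₀ : ℕ, ∀ N : ℕ, N₀ ≤ N →
      ∀ w y : ℕ → ℕ, (∀ q, y q ≤ N) →
        (∑ q ∈ Finset.Icc 1 ⌊(N : ℝ) / Real.log N ^ B⌋₊,
          |∑ n ∈ (Finset.Icc 1 (y q)).filter (fun n : ℕ => n ≡ w q [MOD q]),
            ArithmeticFunction.vonMangoldt n *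
              (ArithmeticFunction.liouville (Int.toNat ((n : ℤ) + h)) : ℝ)|) ≤
          C * N / Real.log N ^ A) := by
  intro H
  have hA : 0 < B + 1 := by linarith
  obtain ⟨C, N₀, H⟩ := H 1 one_ne_zero (B + 1) hA
  have hev := (eventually_logPower_junk_lt B C hB).natCast_atTop
  obtain ⟨N, hjunk, hN⟩ := (hev.and (eventually_ge_atTop (max N₀ 3))).exists
  have hN₀ : N₀ ≤ N := le_trans (le_max_left _ _) hN
  have hN3 : 3 ≤ N := le_trans (le_max_right _ _) hN
  have hNpos : (0 : ℝ) < N := by exact_mod_cast (show 0 < N by omega)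
  -- `1 ≤ log N` (as `N ≥ 3 > e`), so the level is `≤ N`
  have hL1 : 1 ≤ Real.log N := by
    rw [Real.le_log_iff_exp_le hNpos]
    have := Real.exp_one_lt_d9
    have h3 : (3 : ℝ) ≤ N := by exact_mod_cast hN3
    linarith
  have hL0 : 0 < Real.log N := by linarith
  have hLB : 1 ≤ Real.log (N : ℝ) ^ B := Real.one_le_rpow hL1 hB
  have hLB0 : 0 < Real.log (N : ℝ) ^ B := by linarith
  set Q : ℕ := ⌊(N : ℝ) / Real.log N ^ B⌋₊ with hQ
  have hQN : Q ≤ N := by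
    rw [hQ]
    refine Nat.floor_le_of_le ?_
    rw [div_le_iff₀ hLB0]
    nlinarith
  have key := H N hN₀ (fun _ => 0) (fun q => min q N) (fun q => min_le_right q N)
  rw [moduliSum_zero_residue_eq_psi hQN] at key
  have hpsi := Chebyshev.psi_ge Q
  have hQlow : (N : ℝ) / Real.log N ^ B - 1 ≤ Q := by
    have := Nat.lt_floor_add_one ((N : ℝ) / Real.log N ^ B)
    rw [← hQ] at this
    linarith
  have hQle : Real.log ((Q : ℝ) + 1) ≤ Real.log ((N : ℝ) + 1) := by
    apply Real.log_le_log (by positivity)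
    exact_mod_cast Nat.add_le_add_right hQN 1
  have hl2 : 0 < Real.log 2 := Real.log_pos one_lt_two
  have hrhs : C * (N : ℝ) / Real.log N ^ (B + 1) = C * ((N : ℝ) / Real.log N ^ B) / Real.log N := by
    rw [Real.rpow_add_one hL0.ne' B]
    field_simp
  rw [hrhs] at key
  have hprod := mul_le_mul_of_nonneg_right hQlow hl2.le
  linarith

/-- **Level one is refuted**: the crux `LambdaLiouvilleLevel` with moduli `q ≤ N` instead of
`q ≤ ⌊N^{ε₀}⌋` (no `ε₀`; everything else verbatim) is FALSE — the case `B = 0` of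
`not_lambdaLiouvilleLevel_logPowerLevel`: `Σ_{q ≤ N} |…|` with `w ≡ 0`, `y q = q` is
`ψ(N) ≥ N log 2 - log(N+1)`, never `≪ N/log N`. [folklore] -/
theorem not_lambdaLiouvilleLevel_levelOne :
    ¬ (∀ h : ℤ, h ≠ 0 → ∀ A : ℝ, 0 < A → ∃ C : ℝ, ∃ N₀ : ℕ, ∀ N : ℕ, N₀ ≤ N →
      ∀ w y : ℕ → ℕ, (∀ q, y q ≤ N) →
        (∑ q ∈ Finset.Icc 1 N,
          |∑ n ∈ (Finset.Icc 1 (y q)).filter (fun n : ℕ => n ≡ w q [MOD q]),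
            ArithmeticFunction.vonMangoldt n *
              (ArithmeticFunction.liouville (Int.toNat ((n : ℤ) + h)) : ℝ)|) ≤
          C * N / Real.log N ^ A) := by
  intro H
  refine not_lambdaLiouvilleLevel_logPowerLevel (B := 0) le_rfl fun h hh A hA => ?_
  obtain ⟨C, N₀, H⟩ := H h hh A hA
  refine ⟨C, N₀, fun N hN w y hy => ?_⟩
  have hfloor : ⌊(N : ℝ) / Real.log N ^ (0 : ℝ)⌋₊ = N := by
    rw [Real.rpow_zero, div_one, Nat.floor_natCast]
  rw [hfloor]
  exact H N hN w y hy

end Summit.Parity.GeneralizedHardyLittlewood.Theorems.LambdaLiouvilleLevel.Negative
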